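import Literature.AlgebraicGeometry.AbelianSchemes.TangentCocycleOfCechTwoCocycle
import Literature.AlgebraicGeometry.Modules.CechFullCochainRawDegreeTwo
import Literature.AlgebraicGeometry.AbelianSchemes.AbelianVarietyCechCupSurjective
import HarnessLib

/-!
# Every Čech `2`-cocycle of `𝒪_A` on an abelian variety in characteristic `0` is `θ ⌣ dlog g` up to a coboundary
# — the (I1) input of the line-bundle-lift move ([MumfordAV1970] §13; [Oort1971] 2.3.3; [MumfordFogartyKirwan1994] App. 7A)

Topic `AlgebraicGeometry/AbelianSchemes`.  THEOREMS ONLY (no `def`, no instance, no notation, no `sorry`).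
Cell hodgecm-mathlib, F-11 road A, grandchild `F11LiftWithLineBundle`, stub G2: THE (I1) SOCKET of MONO-G2 (B-p13 (g22) v0.3c :413 ∕
★-to-be `AbelianSchemes/AbelianSchemeLineBundleLiftOfSomeLift`), letter = `SOCKET-I1.v0` minus the idle principal-cover binders `b hb`.

Assembly: a linear order on the finite index type (`LinearOrder.lift' (Fintype.equivFin ι)`); J3 = ★
`AbelianVarietyCech.exists_sum_cup_add_d` (F0P1b-p02 (g2), F-J3b 3∕3: every full Čech `2`-cocycle of `𝒪_A` is `∑ᵢ aᵢ ∪ bᵢ + d w`,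
[MumfordAV1970] §13 Cor. 2 via Künneth + the Hopf-algebra argument); ★ `Modules.exists_raw_sum_cup_of_full` (the degree-`≤ 2` raw↔full
dictionary, p799236) reads it in raw letters; then ★ `AbelianSchemeOver.exists_tangentCocycle_of_sum_cup` (p797622: `φ_L` injective ⇒ onto,
per-cocycle vector fields, Leibniz bookkeeping).

HC_CM is proved only modulo the 7 printed citations until rung 0 closes; this file is generic abelian-scheme geometry and asserts
nothing about HC.

## References
* [MumfordAV1970] D. Mumford, *Abelian Varieties* (1970), §13, proof of the Theorem (pp. 125–130) and Cor. 2 (p. 129).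
* [Oort1971] F. Oort, *Finite group schemes, local moduli for abelian varieties, and lifting problems* (1971), §2.3 Lemma 2.3.3.
* [MumfordFogartyKirwan1994] D. Mumford, J. Fogarty, F. Kirwan, *Geometric Invariant Theory*, 3rd ed. (1994), App. 7A (p. 235).
-/

noncomputable section

open CategoryTheory CategoryTheory.Limits AlgebraicGeometry Opposite TopologicalSpace
open Literature.Algebra.Homology Literature.Algebra.Homology.OrderedCech

namespace Literature.AlgebraicGeometry.AbelianSchemes

open Literature.AlgebraicGeometry.Motives Literature.AlgebraicGeometry.Modules
  Literature.AlgebraicGeometry.Morphisms Literature.AlgebraicGeometry.HodgeTheory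

/-- **(I1) — every Čech `2`-cocycle of `𝒪_A` on a finite affine open cover of an abelian scheme `A` over a field of characteristic
`0`, `L` of rank one rigidified (`hε`) and geometrically of an ample class (`hΘ`) framed by `F` on the cover, is `g⁻¹ · θ(dg)` for a
tangent-valued Čech `1`-cocycle `θ` up to a coboundary `h`** — the letters `θ hθcoc h hsh` of ★ `Deformation.exact_correctedUnits_of_move`
with `g := F.tf`, `gi l m := F.tfOn m l _` (`SOCKET-I1.v0` minus the idle principal-cover binders).  J3 (`Ȟ¹ ⊗ Ȟ¹ ↠ Ȟ²`) ∘ the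
raw↔full dictionary ∘ `φ_L` onto. [cite: MumfordAV1970, §13, proof of the Theorem (pp. 125–130)] [cite: Oort1971, §2.3 Lemma 2.3.3]
[cite: MumfordFogartyKirwan1994, App. 7A (p. 235)] -/
theorem AbelianSchemeOver.exists_tangentCocycle_of_cechTwoCocycle {k : Type} [Field k] [CharZero k]
    (A : AbelianSchemeOver (Spec (.of k))) {L : A.left.Modules} (hL : HasRank L 1)
    (hε : CechPic.pullback A.unitSection (detClass (HasRank.isFiniteLocallyFree' hL)) = 1)
    (hΘ : ∀ ⦃Ω : Type⦄ [Field Ω] [IsAlgClosed Ω] (s : Spec (.of Ω) ⟶ Spec (.of k)),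
      ∃ Θ : CartierDivisor (A.fibre s).toAbelianVariety.X.left, Θ.IsAmple ∧
        CechPic.pullback (X := (A.fibre s).toAbelianVariety.X.left) (pullback.fst A.X.hom s)
          (detClass (HasRank.isFiniteLocallyFree' hL)) = Θ.cechClass)
    {ι : Type} [Finite ι] (U : ι → A.X.left.affineOpens) (hcov : ⨆ j, (U j).1 = ⊤)
    (F : IFrames L (fun j => (U j).1))
    (s : (j l m : ι) → Γ(A.X.left, (U j).1 ⊓ (U l).1 ⊓ (U m).1))
    (hs : ∀ j l m n : ι,
      A.X.left.presheaf.map (homOfLE (le_inf (le_inf (inf_le_left.trans (inf_le_left.trans inf_le_right))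
            (inf_le_left.trans inf_le_right)) inf_le_right :
          (U j).1 ⊓ (U l).1 ⊓ (U m).1 ⊓ (U n).1 ≤ (U l).1 ⊓ (U m).1 ⊓ (U n).1)).op (s l m n) -
        A.X.left.presheaf.map (homOfLE (le_inf (le_inf (inf_le_left.trans (inf_le_left.trans inf_le_left))
            (inf_le_left.trans inf_le_right)) inf_le_right :
          (U j).1 ⊓ (U l).1 ⊓ (U m).1 ⊓ (U n).1 ≤ (U j).1 ⊓ (U m).1 ⊓ (U n).1)).op (s j m n) +
        A.X.left.presheaf.map (homOfLE (le_inf (inf_le_left.trans inf_le_left) inf_le_right :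
          (U j).1 ⊓ (U l).1 ⊓ (U m).1 ⊓ (U n).1 ≤ (U j).1 ⊓ (U l).1 ⊓ (U n).1)).op (s j l n) -
        A.X.left.presheaf.map (homOfLE (inf_le_left :
          (U j).1 ⊓ (U l).1 ⊓ (U m).1 ⊓ (U n).1 ≤ (U j).1 ⊓ (U l).1 ⊓ (U m).1)).op (s j l m) = 0) :
    ∃ (θ : (j l : ι) → ((cotangentSheaf A.X).over ((U j).1 ⊓ (U l).1) ⟶ (unitModule A.X.left).over ((U j).1 ⊓ (U l).1)))
      (_ : ∀ j l m : ι,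
        restrictHom (homOfLE (inf_le_left : (U j).1 ⊓ (U l).1 ⊓ (U m).1 ≤ (U j).1 ⊓ (U l).1)) (θ j l) +
          restrictHom (homOfLE (le_inf (inf_le_left.trans inf_le_right) inf_le_right :
            (U j).1 ⊓ (U l).1 ⊓ (U m).1 ≤ (U l).1 ⊓ (U m).1)) (θ l m) =
          restrictHom (homOfLE (le_inf (inf_le_left.trans inf_le_left) inf_le_right :
            (U j).1 ⊓ (U l).1 ⊓ (U m).1 ≤ (U j).1 ⊓ (U m).1)) (θ j m))
      (h : (j l : ι) → Γ(A.X.left, (U j).1 ⊓ (U l).1)),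
      ∀ j l m : ι, s j l m =
        A.X.left.presheaf.map (homOfLE (le_inf (inf_le_left.trans inf_le_right) inf_le_right :
            (U j).1 ⊓ (U l).1 ⊓ (U m).1 ≤ (U l).1 ⊓ (U m).1)).op
            (F.tfOn m l ((U l).1 ⊓ (U m).1) inf_le_right inf_le_left) *
          (show Γ(A.X.left, (U j).1 ⊓ (U l).1 ⊓ (U m).1) from
            appLE (restrictHom (homOfLE (inf_le_left : (U j).1 ⊓ (U l).1 ⊓ (U m).1 ≤ (U j).1 ⊓ (U l).1)) (θ j l))
              (𝟙 _) (dSection A.X _ (A.X.left.presheaf.map (homOfLE (le_inf (inf_le_left.trans inf_le_right)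
                inf_le_right : (U j).1 ⊓ (U l).1 ⊓ (U m).1 ≤ (U l).1 ⊓ (U m).1)).op (F.tf l m)))) +
        (A.X.left.presheaf.map (homOfLE (le_inf (inf_le_left.trans inf_le_left) inf_le_right :
            (U j).1 ⊓ (U l).1 ⊓ (U m).1 ≤ (U j).1 ⊓ (U m).1)).op (h j m) -
          A.X.left.presheaf.map (homOfLE (inf_le_left : (U j).1 ⊓ (U l).1 ⊓ (U m).1 ≤ (U j).1 ⊓ (U l).1)).op (h j l) -
          A.X.left.presheaf.map (homOfLE (le_inf (inf_le_left.trans inf_le_right) inf_le_right :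
            (U j).1 ⊓ (U l).1 ⊓ (U m).1 ≤ (U l).1 ⊓ (U m).1)).op (h l m)) := by
  classical
  letI : Fintype ι := Fintype.ofFinite ι
  letI : LinearOrder ι := LinearOrder.lift' (Fintype.equivFin ι) (Fintype.equivFin ι).injective
  obtain ⟨σ, _, a, c, ha, hc, h', hJ3⟩ := Modules.exists_raw_sum_cup_of_full (fun j => (U j).1)
    (scalarRingHomTop A.X) s hs (AbelianVarietyCech.exists_sum_cup_add_d A U hcov)
  exact A.exists_tangentCocycle_of_sum_cup hL hε hΘ U hcov F s a c ha hc h' hJ3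

end Literature.AlgebraicGeometry.AbelianSchemes

end
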